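import Summits.QuantumFields.YangMills.Theorems.InfiniteVolumeLatticeDistributions
import Literature.MathematicalPhysics.QuantumFieldTheory.SchwingerLimitInheritance
import Literature.MathematicalPhysics.QuantumFieldTheory.Balaban1983to89.InfiniteVolumeSufficientIV
import HarnessLib

/-!
# Infinite volume by compactness, step 4: translations pass through the «`L → ∞` first, then `a → 0`» limit

HONEST FRAMING (cell `ym-fleet`, seat `ym-infvol-p2`, director-ym R136 (i) «INFINITE-VOLUME ∕ CONTINUUM-FROM-UV
ROUTE», pre-birth helper; bears on LADDER-YM R1∕R2a).  Pure soft analysis, kernel-checked; NOTHING here is a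
statement about Bałaban's renormalisation group, rotations (the E1 half that `ROT` carries), reflection positivity,
uniqueness of the infinite-volume state, a mass gap, or Clay.  The only Yang–Mills-specific input type is the
spine's UV-leg currency `MomentBounds6 G r a`, consumed as a HYPOTHESIS (§4); §§1–3 are abstract.

WHY.  In an infinite-volume state `μ` that is `ℤ⁴`-translation invariant (every thermodynamic limit point of the
torus-projective family is: tree `isZdTranslationInvariant_of_mem_infiniteVolumeLimitPoints`), the plane-string series
`F ↦ Σ'ₓ W_μ(q,x)·F(a·x + o)` is EXACTLY invariant under translations by lattice vectors `a·v`, `v ∈ ℤ⁴` — no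
wrap-around, no shift defect (§2); lattice vectors `a_k·⌊t/a_k⌋ → t` as `a_k → 0`, and the a-uniform E0′ bound on
`⁰𝒮ₙ` (step 2) is the equicontinuity that carries invariance to the limit functionals (§1, the Literature argument
`translateMulti_apply_eq_of_tendsto` re-run for bare functionals).  This is the translation half of E1 for the
continuum-data candidates of step 3.

WHAT IS PROVED ([folklore] throughout).
* §1 `translate_eq_of_tendsto` — abstract inheritance: additive functionals `s_j` on `⁰𝒮ₙ` with a uniform bound,
  converging to `S` on `⁰𝒮ₙ`, each exactly invariant under `translateMulti (b j)` with `b j → t` ⟹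
  `S (translateMulti t F) = S F` on `⁰𝒮ₙ`; `exists_latticeVector_near` (`‖t − a·v‖ ≤ 2a` for some `v ∈ ℤ⁴`).
* §2 `tsum_weight_mul_translateMulti` (tree `siteToE_sub` BY NAME) — EXACT lattice invariance: for a weight with
  `W (x + v) = W x` and affine evaluation points `a·x_l + o_l`,
  `Σ'ₓ W(x)·(translateMulti (a·v) F)(a·x + o) = Σ'ₓ W(x)·F(a·x + o)`.
* §3 `plane_add_eq_configShift`, **`infVolWeight_translate`** — the centred plane-string weights of a
  `ℤ⁴`-translation-invariant measure are translation invariant; `infVolWeight_translate_oddTorusLimitPoints`.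
* §4 **`translateMulti_invariant_of_tendsto_oddTorusLimitPoints`** — for ANY coupling sequence with `a(β_k) → 0`,
  states `μ_k ∈ oddTorusLimitPoints r (β_k)`, affine offsets `‖o‖ ≤ 5a`, ANY subsequence `φ` and ANY functional
  `S` to which the series of `μ_{φ j}` converge on `⁰𝒮ₙ` under a uniform bound: `S (translateMulti t F) = S F`;
  and the packaged existence **`exists_subseq_limit_translate_oddTorusLimitPoints`** = step 3's
  `exists_subseq_limit_oddTorusLimitPoints` for affine offset schemes WITH translation invariance of every `S n q`
  on `⁰𝒮ₙ` (`n ≥ 2`, valid `q`), given `MomentBounds6 G r a` and `a(β_k) → 0`.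

References: Glimm–Jaffe (1987) §6.1; Osterwalder–Schrader CMP 42 (1975) §4; Chatterjee arXiv:1803.01950 §§2, 5.
-/

set_option autoImplicit false

noncomputable section

open scoped BigOperators SchwartzMap
open MeasureTheory Filter Topology
open Literature.MathematicalPhysics.QuantumFieldTheory hiding ZdEdge
open Literature.MathematicalPhysics.QuantumLattice
open Literature.MathematicalPhysics.AQFT
open Literature.Probability.LatticeModels (box Site)
open Summit.QuantumFields.YangMills.Cruxes.OSLegsFromFemtoAndGap.DlrCollarTransfer
  (plane torusE MomentBounds6 exists_abs_plane_le)
open Summit.QuantumFields.YangMills.Theorems.OSLegsFromFemtoAndGap (siteToE_sub)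

namespace Summit.QuantumFields.YangMills.Theorems.InfiniteVolume

/-! ## §1 Abstract inheritance of translation invariance; lattice vectors near a point -/

section Abstract

variable {n : ℕ}

/-- **Translation invariance of a limit from EXACT invariance along the sequence.**  Functionals `s j` on
`𝓢((Fin n → E4), ℂ)`, additive on `⁰𝒮ₙ`, uniformly bounded there by `σ·‖·‖_m`, converging to `S` on `⁰𝒮ₙ`, each
exactly invariant under `translateMulti (b j)` with `b j → t`: then `S (translateMulti t F) = S F` for `F ∈ ⁰𝒮ₙ`
(equicontinuity + strong continuity of translations on `𝓢`, as in the Literature lemma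
`translateMulti_apply_eq_of_tendsto`). [folklore] -/
theorem translate_eq_of_tendsto (s : ℕ → 𝓢((Fin n → EuclideanSpace ℝ (Fin 4)), ℂ) → ℂ)
    (S : 𝓢((Fin n → EuclideanSpace ℝ (Fin 4)), ℂ) → ℂ)
    (hsub : ∀ j (F G : 𝓢((Fin n → EuclideanSpace ℝ (Fin 4)), ℂ)), IsOffDiagonal F → IsOffDiagonal G →
      s j (F - G) = s j F - s j G)
    {σ : ℝ} {m : ℕ} (hb : ∀ j (F : 𝓢((Fin n → EuclideanSpace ℝ (Fin 4)), ℂ)), IsOffDiagonal F →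
      ‖s j F‖ ≤ σ * schwartzNorm m F)
    (hconv : ∀ F : 𝓢((Fin n → EuclideanSpace ℝ (Fin 4)), ℂ), IsOffDiagonal F →
      Tendsto (fun j => s j F) atTop (𝓝 (S F)))
    {t : EuclideanSpace ℝ (Fin 4)} {b : ℕ → EuclideanSpace ℝ (Fin 4)} (hbt : Tendsto b atTop (𝓝 t))
    (hinv : ∀ j (F : 𝓢((Fin n → EuclideanSpace ℝ (Fin 4)), ℂ)), IsOffDiagonal F →
      s j (translateMulti (b j) F) = s j F)
    (F : 𝓢((Fin n → EuclideanSpace ℝ (Fin 4)), ℂ)) (hF : IsOffDiagonal F) :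
    S (translateMulti t F) = S F := by
  have hτ : Tendsto (fun j => translateMulti (b j) F) atTop (𝓝 (translateMulti t F)) :=
    ((continuous_translateMulti F).tendsto t).comp hbt
  have hqc : Continuous fun G : 𝓢((Fin n → EuclideanSpace ℝ (Fin 4)), ℂ) => schwartzNorm m G :=
    Seminorm.continuous_finsetSup (s := Finset.Iic (m, m)) fun i _ =>
      (schwartz_withSeminorms ℂ (Fin n → EuclideanSpace ℝ (Fin 4)) ℂ).continuous_seminorm i
  have h1 : Tendsto (fun j => translateMulti t F - translateMulti (b j) F) atTop (𝓝 0) := by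
    simpa using (tendsto_const_nhds (x := translateMulti t F)).sub hτ
  have hN : Tendsto (fun j => schwartzNorm m (translateMulti t F - translateMulti (b j) F)) atTop (𝓝 0) := by
    have h2 := (hqc.tendsto 0).comp h1
    rwa [show schwartzNorm m (0 : 𝓢((Fin n → EuclideanSpace ℝ (Fin 4)), ℂ)) = 0 from map_zero _] at h2
  -- equicontinuity: `s j (F(· - t)) - s j (F(· - b j)) → 0`
  have h3 : Tendsto (fun j => s j (translateMulti t F - translateMulti (b j) F)) atTop (𝓝 0) := by
    refine squeeze_zero_norm (fun j => hb j _ ((hF.translateMulti t).sub (hF.translateMulti (b j)))) ?_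
    simpa using hN.const_mul σ
  have h4 : Tendsto (fun j => s j (translateMulti t F) - s j F) atTop (𝓝 0) := by
    refine h3.congr fun j => ?_
    rw [hsub j _ _ (hF.translateMulti t) (hF.translateMulti (b j)), hinv j F hF]
  have h6 : S (translateMulti t F) - S F = 0 :=
    tendsto_nhds_unique ((hconv _ (hF.translateMulti t)).sub (hconv F hF)) h4
  exact sub_eq_zero.1 h6

/-- **Lattice vectors are `2a`-dense at scale `a`**: for `0 < a` and `t ∈ E4` there is `v ∈ ℤ⁴` with
`‖t − a·v‖ ≤ 2a` (coordinatewise floor). [folklore] -/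
theorem exists_latticeVector_near {a : ℝ} (ha : 0 < a) (t : EuclideanSpace ℝ (Fin 4)) :
    ∃ v : Site 4, ‖t - a • siteToE v‖ ≤ 2 * a := by
  refine ⟨fun i => ⌊t i / a⌋, ?_⟩
  have hcoord : ∀ i : Fin 4, ‖(t - a • siteToE (fun i => ⌊t i / a⌋)) i‖ ≤ a := fun i => by
    have h0 : (t - a • siteToE (fun i => ⌊t i / a⌋)) i = t i - a * ⌊t i / a⌋ := by
      simp [siteToE_apply, smul_eq_mul]
    rw [h0, Real.norm_eq_abs]
    have h1 : (⌊t i / a⌋ : ℝ) ≤ t i / a := Int.floor_le _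
    have h2 : t i / a < ⌊t i / a⌋ + 1 := Int.lt_floor_add_one _
    have h3 : a * ⌊t i / a⌋ ≤ t i := by
      have := mul_le_mul_of_nonneg_left h1 ha.le; rwa [mul_div_cancel₀ _ ha.ne'] at this
    have h4 : t i < a * ⌊t i / a⌋ + a := by
      have := mul_lt_mul_of_pos_left h2 ha; rw [mul_add, mul_one, mul_div_cancel₀ _ ha.ne'] at this; exact this
    rw [abs_le]; constructor <;> linarith
  calc ‖t - a • siteToE (fun i => ⌊t i / a⌋)‖
      = Real.sqrt (∑ i, ‖(t - a • siteToE (fun i => ⌊t i / a⌋)) i‖ ^ 2) := EuclideanSpace.norm_eq _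
    _ ≤ Real.sqrt (∑ _i : Fin 4, a ^ 2) := by
        gcongr with i
        exact hcoord i
    _ = 2 * a := by
        rw [Finset.sum_const, Finset.card_univ, Fintype.card_fin, nsmul_eq_mul,
          show ((4 : ℕ) : ℝ) * a ^ 2 = (2 * a) ^ 2 by push_cast; ring]
        exact Real.sqrt_sq (by positivity)

end Abstract

/-! ## §2 Exact lattice translation invariance of the series functional -/

section Lattice

variable {n : ℕ}

/-- **EXACT invariance under lattice translations.**  For a weight on `(ℤ⁴)ⁿ` with `W (x + v) = W x` (simultaneous
translation of all sites by `v ∈ ℤ⁴`) and affine evaluation points `a·x_l + o_l`: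
`Σ'ₓ W(x)·(translateMulti (a·v) F)(a·x + o) = Σ'ₓ W(x)·F(a·x + o)` (reindex `x ↦ x − v`). [folklore] -/
theorem tsum_weight_mul_translateMulti (W : (Fin n → Site 4) → ℝ) (v : Site 4)
    (hW : ∀ x : Fin n → Site 4, W (fun l => x l + v) = W x) (a : ℝ) (o : Fin n → EuclideanSpace ℝ (Fin 4))
    (F : 𝓢((Fin n → EuclideanSpace ℝ (Fin 4)), ℂ)) :
    ∑' x : Fin n → Site 4, ((W x : ℝ) : ℂ) * translateMulti (a • siteToE v) F (fun l => a • siteToE (x l) + o l) =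
      ∑' x : Fin n → Site 4, ((W x : ℝ) : ℂ) * F (fun l => a • siteToE (x l) + o l) := by
  set c : Fin n → Site 4 := fun _ => v with hc
  have hre : ∀ x : Fin n → Site 4,
      translateMulti (a • siteToE v) F (fun l => a • siteToE (x l) + o l) =
        F (fun l => a • siteToE ((x - c) l) + o l) := fun x => by
    rw [translateMulti_apply]
    congr 1
    funext l
    rw [Pi.sub_apply, hc, siteToE_sub, smul_sub]
    abel
  simp_rw [hre]
  rw [← (Equiv.addRight c).tsum_eq
    (fun x : Fin n → Site 4 => ((W x : ℝ) : ℂ) * F (fun l => a • siteToE ((x - c) l) + o l))]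
  refine tsum_congr fun x => ?_
  simp only [Equiv.coe_addRight, add_sub_cancel_right]
  congr 2
  exact_mod_cast hW x

end Lattice

/-! ## §3 Translation invariance of the weights of a translation-invariant state -/

section State

variable {G : Type} [Group G] [TopologicalSpace G] [MeasurableSpace G]

/-- The single-plane field at `x + v` is the field at `x` of the configuration translated by `−v`. [folklore] -/
theorem plane_add_eq_configShift (r : LatticeRep G) (q : Fin 4 × Fin 4) (x v : Site 4) (U : LGConfig 4 G) :
    plane G r q (x + v) U = plane G r q x (configShift (-v) U) := by
  unfold plane
  congr 1
  funext e
  simp only [configShift_apply, neg_add, sub_sub]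

/-- **The centred plane-string weights of a `ℤ⁴`-translation-invariant measure are translation invariant.** [folklore] -/
theorem infVolWeight_translate (r : LatticeRep G) (μ : Measure (LGConfig 4 G)) (hμ : IsZdTranslationInvariant μ)
    {n : ℕ} (q : Fin n → Fin 4 × Fin 4) (x : Fin n → Site 4) (v : Site 4) :
    ∫ U, ∏ i, (plane G r (q i) (x i + v) U - ∫ V, plane G r (q i) (x i + v) V ∂μ) ∂μ =
      ∫ U, ∏ i, (plane G r (q i) (x i) U - ∫ V, plane G r (q i) (x i) V ∂μ) ∂μ := by
  have hshift : ∀ f : LGConfig 4 G → ℝ, ∫ U, f (configShift (-v) U) ∂μ = ∫ U, f U ∂μ := fun f => by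
    rw [← integral_map_equiv (configShift (G := G) (-v)) f, hμ (-v)]
  have hmean : ∀ i, ∫ V, plane G r (q i) (x i + v) V ∂μ = ∫ V, plane G r (q i) (x i) V ∂μ := fun i => by
    simp_rw [plane_add_eq_configShift]
    exact hshift _
  simp_rw [hmean, plane_add_eq_configShift]
  exact hshift (fun U => ∏ i, (plane G r (q i) (x i) U - ∫ V, plane G r (q i) (x i) V ∂μ))

end State

section OddTorusWeights

variable {G : Type} [Group G] [TopologicalSpace G] [IsTopologicalGroup G] [CompactSpace G]
  [MeasurableSpace G] [BorelSpace G]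

/-- **Odd-torus limit states have translation-invariant plane-string weights** (they are `ℤ⁴`-translation
invariant: tree `isZdTranslationInvariant_of_mem_infiniteVolumeLimitPoints`, second countability of `G` through the
faithful representation `r`). [folklore] -/
theorem infVolWeight_translate_oddTorusLimitPoints (r : LatticeRep G) {β : ℝ} {μ : Measure (LGConfig 4 G)}
    (hμ : μ ∈ oddTorusLimitPoints r β) {n : ℕ} (q : Fin n → Fin 4 × Fin 4) (x : Fin n → Site 4) (v : Site 4) :
    ∫ U, ∏ i, (plane G r (q i) (x i + v) U - ∫ V, plane G r (q i) (x i + v) V ∂μ) ∂μ =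
      ∫ U, ∏ i, (plane G r (q i) (x i) U - ∫ V, plane G r (q i) (x i) V ∂μ) ∂μ := by
  haveI : SecondCountableTopology G :=
    (r.continuous.isClosedEmbedding r.injective).isEmbedding.secondCountableTopology
  haveI : T2Space G := (r.continuous.isClosedEmbedding r.injective).isEmbedding.t2Space
  obtain ⟨S, hS, hlim⟩ := hμ
  have hmem : μ ∈ infiniteVolumeLimitPoints (d := 4) r.ρ β :=
    ⟨fun k => 2 * S k, fun i j hij => by have := hS hij; dsimp only; omega, hlim⟩
  exact infVolWeight_translate r μ (isZdTranslationInvariant_of_mem_infiniteVolumeLimitPoints r.ρ hmem) q x v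

end OddTorusWeights

/-! ## §4 Translations pass to the limit functionals of odd-torus limit states -/

section OddTorus

variable {G : Type} [Group G] [TopologicalSpace G] [IsTopologicalGroup G] [CompactSpace G]
  [MeasurableSpace G] [BorelSpace G]

/-- **TRANSLATION INVARIANCE OF THE LIMIT, for any admissible data.**  `MomentBounds6 G r a` with constants
`(C, β₄, ℓ₄)`; a coupling sequence `β_k ≥ β₄` with `0 < a(β_k) ≤ 1/24`, `a(β_k) ≤ ℓ₄` and `a(β_k) → 0`; states
`μ_k ∈ oddTorusLimitPoints r (β_k)`; an arity `n ≥ 2`, a valid string `q`, affine offsets `o k` with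
`‖o k l‖ ≤ 5·a(β_k)`; ANY subsequence `φ` and ANY `S` with
`Σ'ₓ W_{μ_{φ j}}(q,x)·F(a(β_{φ j})·x + o (φ j)) → S F` on `⁰𝒮ₙ`.  Then `S (translateMulti t F) = S F` for every
`t ∈ E4` and `F ∈ ⁰𝒮ₙ`. [folklore] -/
theorem translateMulti_invariant_of_tendsto_oddTorusLimitPoints (r : LatticeRep G) {a : ℝ → ℝ} {C β₄ ℓ₄ : ℝ}
    (hℓ : 0 < ℓ₄) (hC : 0 ≤ C)
    (H : ∀ β : ℝ, β₄ ≤ β →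
      ∀ (L n : ℕ) (q : Fin n → Fin 4 × Fin 4) (x : Fin n → (Fin 4 → ℤ)) (R : ℕ), (∀ i, (q i).1 < (q i).2) →
        1 ≤ R → (R : ℝ) * a β ≤ ℓ₄ → 4 * R + 8 ≤ L →
        (∀ i j : Fin n, i ≠ j → ∃ k : Fin 4,
          (2 * (R : ℤ) + 4) ≤ |((((x i k - x j k : ℤ) : ZMod (2 * L + 1))).valMinAbs : ℤ)|) →
        |torusE G r β L (fun U => ∏ i, (plane G r (q i) (x i) U - torusE G r β L (plane G r (q i) (x i))))| ≤
          (C / (R : ℝ) ^ 4) ^ n)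
    (β : ℕ → ℝ) (hβ : ∀ k, β₄ ≤ β k) (ha : ∀ k, 0 < a (β k)) (ha24 : ∀ k, a (β k) ≤ 1 / 24)
    (haℓ : ∀ k, a (β k) ≤ ℓ₄) (ha0 : Tendsto (fun k => a (β k)) atTop (𝓝 0))
    (μ : ℕ → Measure (LGConfig 4 G)) (hμ : ∀ k, μ k ∈ oddTorusLimitPoints r (β k))
    {n : ℕ} (hn : 2 ≤ n) (q : Fin n → Fin 4 × Fin 4) (hq : ∀ i, (q i).1 < (q i).2)
    (o : ℕ → Fin n → EuclideanSpace ℝ (Fin 4)) (ho : ∀ k l, ‖o k l‖ ≤ 5 * a (β k))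
    {φ : ℕ → ℕ} (hφ : StrictMono φ) (S : 𝓢((Fin n → EuclideanSpace ℝ (Fin 4)), ℂ) → ℂ)
    (hconv : ∀ F : 𝓢((Fin n → EuclideanSpace ℝ (Fin 4)), ℂ), IsOffDiagonal F →
      Tendsto (fun j => ∑' x : Fin n → Site 4,
        (((∫ U, ∏ i, (plane G r (q i) (x i) U - ∫ V, plane G r (q i) (x i) V ∂(μ (φ j))) ∂(μ (φ j)) : ℝ) : ℂ)) *
          F (fun l => a (β (φ j)) • siteToE (x l) + o (φ j) l)) atTop (𝓝 (S F)))
    (t : EuclideanSpace ℝ (Fin 4)) (F : 𝓢((Fin n → EuclideanSpace ℝ (Fin 4)), ℂ)) (hF : IsOffDiagonal F) :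
    S (translateMulti t F) = S F := by
  obtain ⟨Cp, hCp⟩ := exists_abs_plane_le (G := G) r
  have hCp0 : 0 ≤ Cp := le_trans (abs_nonneg _) (hCp (0, 1) 0 (fun _ => 1))
  haveI : ∀ k, IsProbabilityMeasure (μ k) := fun k => by
    obtain ⟨S', -, hlim⟩ := hμ k
    exact hlim.1
  have ha1 : ∀ k, a (β k) ≤ 1 := fun k => (ha24 k).trans (by norm_num)
  have hsa : ∀ k, 6 * a (β k) ≤ 1 / 4 := fun k => by linarith [ha24 k]
  -- shorthand: weights, evaluation maps
  set W : ℕ → (Fin n → Site 4) → ℝ := fun k x =>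
    ∫ U, ∏ i, (plane G r (q i) (x i) U - ∫ V, plane G r (q i) (x i) V ∂(μ k)) ∂(μ k) with hWdef
  set y : ℕ → (Fin n → Site 4) → (Fin n → EuclideanSpace ℝ (Fin 4)) := fun k x l =>
    a (β k) • siteToE (x l) + o k l with hydef
  have hyx : ∀ k x l, ‖y k x l - a (β k) • siteToE (x l)‖ ≤ 6 * a (β k) := fun k x l => by
    simp only [hydef, add_sub_cancel_left]
    linarith [ho k l, (ha k).le]
  have hWsup : ∀ k x, |W k x| ≤ (Cp + Cp) ^ n := fun k x => abs_infVolWeight_le r hCp (μ k) q x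
  have hWcol : ∀ k (x : Fin n → Site 4) (R : ℕ), 1 ≤ R → (R : ℝ) * a (β k) ≤ ℓ₄ →
      (∀ i j : Fin n, i ≠ j → ∃ m : Fin 4, (2 * (R : ℤ) + 4) ≤ |x i m - x j m|) →
      |W k x| ≤ (C / (R : ℝ) ^ 4) ^ n := fun k x R hR hRa hsep =>
    momentBounds6_oddTorusLimitPoints r H (hβ k) (hμ k) q x R hq hR hRa hsep
  -- the functionals along `φ`
  set s : ℕ → 𝓢((Fin n → EuclideanSpace ℝ (Fin 4)), ℂ) → ℂ := fun j F =>
    ∑' x : Fin n → Site 4, ((W (φ j) x : ℝ) : ℂ) * F (y (φ j) x) with hsdef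
  have hsum : ∀ j (F : 𝓢((Fin n → EuclideanSpace ℝ (Fin 4)), ℂ)),
      Summable fun x : Fin n → Site 4 => ((W (φ j) x : ℝ) : ℂ) * F (y (φ j) x) := fun j F =>
    summable_mul_of_bounded (ha (φ j)) (ha1 (φ j)) (hsa (φ j)) (pow_nonneg (by positivity) n) (W (φ j))
      (hWsup (φ j)) F (y (φ j)) (hyx (φ j))
  have hsub : ∀ j (F G' : 𝓢((Fin n → EuclideanSpace ℝ (Fin 4)), ℂ)), IsOffDiagonal F → IsOffDiagonal G' →
      s j (F - G') = s j F - s j G' := fun j F G' _ _ => by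
    simp only [hsdef]
    rw [← Summable.tsum_sub (hsum j F) (hsum j G')]
    exact tsum_congr fun x => by simp only [sub_apply]; ring
  set K : ℝ := ((Cp + Cp) * 4 ^ 4 * 5 ^ 6 + (Cp + Cp) * 2 ^ 6 * (10 + 2 * 6) ^ 4 +
      16 * C * 2 ^ 6 * (2 / ℓ₄ + 48) ^ 4) * 2 ^ 6 * (81 * ∑' m : ℕ, (((m : ℝ) + 1) ^ 2)⁻¹) with hK
  have hbd : ∀ j (F : 𝓢((Fin n → EuclideanSpace ℝ (Fin 4)), ℂ)), IsOffDiagonal F →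
      ‖s j F‖ ≤ 5 * K ^ n * schwartzNorm (10 * n) F := fun j F hF =>
    norm_tsum_weight_mul_le hℓ hC (by positivity : 0 ≤ Cp + Cp) (W (φ j)) (hWsup (φ j)) (hWcol (φ j))
      (ha (φ j)) (ha1 (φ j)) (haℓ (φ j)) hn (by norm_num) le_rfl (hsa (φ j)) F hF (y (φ j)) (hyx (φ j))
  -- lattice vectors approximating `t`, exact invariance along the sequence
  have hv := fun j => exists_latticeVector_near (ha (φ j)) t
  choose v hv using hv
  have hbt : Tendsto (fun j => a (β (φ j)) • siteToE (v j)) atTop (𝓝 t) := by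
    have ha0' : Tendsto (fun j => 2 * a (β (φ j))) atTop (𝓝 0) := by
      simpa using (ha0.comp hφ.tendsto_atTop).const_mul 2
    rw [tendsto_iff_norm_sub_tendsto_zero]
    refine squeeze_zero (fun j => norm_nonneg _) (fun j => ?_) ha0'
    rw [norm_sub_rev]; exact hv j
  have hinv : ∀ j (F : 𝓢((Fin n → EuclideanSpace ℝ (Fin 4)), ℂ)), IsOffDiagonal F →
      s j (translateMulti (a (β (φ j)) • siteToE (v j)) F) = s j F := fun j F _ => by
    simp only [hsdef, hydef]
    exact tsum_weight_mul_translateMulti (W (φ j)) (v j)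
      (fun x => infVolWeight_translate_oddTorusLimitPoints r (hμ (φ j)) q x (v j)) _ (o (φ j)) F
  exact translate_eq_of_tendsto s S hsub hbd hconv hbt hinv F hF

/-- **THE COMPACTNESS STEP WITH TRANSLATIONS.**  From `MomentBounds6 G r a`: thresholds `β₄`, `ℓ₄` and ONE `K` such
that for every coupling sequence `β_k ≥ β₄` with `0 < a(β_k) ≤ min (1/24) ℓ₄` AND `a(β_k) → 0`, every choice of
states `μ_k ∈ oddTorusLimitPoints r (β_k)` and every affine offset scheme `o` (`‖o k n q l‖ ≤ 5·a(β_k)`: base points,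
plaquette centres, …) there are a subsequence `φ` and continuous linear functionals `S n q` with the E0′ bound,
convergence of the centred plane-string series of `μ_{φ j}` on `⁰𝒮ₙ` (`n ≥ 2`, valid `q`), AND
`S n q (translateMulti t F) = S n q F` for all `t ∈ E4`, `F ∈ ⁰𝒮ₙ`. [folklore] -/
theorem exists_subseq_limit_translate_oddTorusLimitPoints (r : LatticeRep G) {a : ℝ → ℝ}
    (hMB : MomentBounds6 G r a) :
    ∃ (β₄ ℓ₄ K : ℝ), 0 < ℓ₄ ∧ 0 ≤ K ∧
      ∀ (β : ℕ → ℝ), (∀ k, β₄ ≤ β k) → (∀ k, 0 < a (β k)) → (∀ k, a (β k) ≤ 1 / 24) → (∀ k, a (β k) ≤ ℓ₄) →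
        Tendsto (fun k => a (β k)) atTop (𝓝 0) →
      ∀ (μ : ℕ → Measure (LGConfig 4 G)), (∀ k, μ k ∈ oddTorusLimitPoints r (β k)) →
      ∀ (o : ℕ → (n : ℕ) → (Fin n → Fin 4 × Fin 4) → Fin n → EuclideanSpace ℝ (Fin 4)),
        (∀ k n q l, ‖o k n q l‖ ≤ 5 * a (β k)) →
      ∃ φ : ℕ → ℕ, StrictMono φ ∧
        ∃ S : (n : ℕ) → (Fin n → Fin 4 × Fin 4) → (𝓢((Fin n → EuclideanSpace ℝ (Fin 4)), ℂ) →L[ℂ] ℂ),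
          (∀ n q F, ‖S n q F‖ ≤ 5 * K ^ n * schwartzNorm (10 * n) F) ∧
          (∀ n : ℕ, 2 ≤ n → ∀ q : Fin n → Fin 4 × Fin 4, (∀ i, (q i).1 < (q i).2) →
            ∀ F : 𝓢((Fin n → EuclideanSpace ℝ (Fin 4)), ℂ), IsOffDiagonal F →
              Tendsto (fun j => ∑' x : Fin n → Site 4,
                (((∫ U, ∏ i, (plane G r (q i) (x i) U - ∫ V, plane G r (q i) (x i) V ∂(μ (φ j))) ∂(μ (φ j)) : ℝ)
                  : ℂ)) * F (fun l => a (β (φ j)) • siteToE (x l) + o (φ j) n q l)) atTop (𝓝 (S n q F))) ∧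
          ∀ n : ℕ, 2 ≤ n → ∀ q : Fin n → Fin 4 × Fin 4, (∀ i, (q i).1 < (q i).2) →
            ∀ (t : EuclideanSpace ℝ (Fin 4)) (F : 𝓢((Fin n → EuclideanSpace ℝ (Fin 4)), ℂ)), IsOffDiagonal F →
              S n q (translateMulti t F) = S n q F := by
  obtain ⟨C, β₄, ℓ₄, hℓ, hC, H⟩ := hMB
  obtain ⟨β₄', ℓ₄', K, hℓ', hK, hex⟩ :=
    exists_subseq_limit_oddTorusLimitPoints r (⟨C, β₄, ℓ₄, hℓ, hC, H⟩ : MomentBounds6 G r a)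
  -- re-run step 3 with the SAME witnesses: its proof chose `β₄' = β₄`, `ℓ₄' = ℓ₄`, but we only need SOME thresholds,
  -- so we take the maxima / minima of both sets
  refine ⟨max β₄ β₄', min ℓ₄ ℓ₄', K, lt_min hℓ hℓ', hK, ?_⟩
  intro β hβ ha ha24 haℓ ha0 μ hμ o ho
  have hβ₁ : ∀ k, β₄ ≤ β k := fun k => le_trans (le_max_left _ _) (hβ k)
  have hβ₂ : ∀ k, β₄' ≤ β k := fun k => le_trans (le_max_right _ _) (hβ k)
  have hℓ₁ : ∀ k, a (β k) ≤ ℓ₄ := fun k => (haℓ k).trans (min_le_left _ _)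
  have hℓ₂ : ∀ k, a (β k) ≤ ℓ₄' := fun k => (haℓ k).trans (min_le_right _ _)
  have hy : ∀ k n (q : Fin n → Fin 4 × Fin 4) (x : Fin n → Site 4) l,
      ‖(fun l => a (β k) • siteToE (x l) + o k n q l) l - a (β k) • siteToE (x l)‖ ≤ 6 * a (β k) :=
    fun k n q x l => by
      simp only [add_sub_cancel_left]
      linarith [ho k n q l, (ha k).le]
  obtain ⟨φ, hφ, S, hS, hconv⟩ := hex β hβ₂ ha ha24 hℓ₂ μ hμ
    (fun k n q x l => a (β k) • siteToE (x l) + o k n q l) hy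
  refine ⟨φ, hφ, S, hS, hconv, fun n hn q hq t F hF => ?_⟩
  exact translateMulti_invariant_of_tendsto_oddTorusLimitPoints r hℓ hC H β hβ₁ ha ha24 hℓ₁ ha0 μ hμ hn q hq
    (fun k => o k n q) (fun k l => ho k n q l) hφ (S n q) (hconv n hn q hq) t F hF

end OddTorus

end Summit.QuantumFields.YangMills.Theorems.InfiniteVolume

end
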